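import Summits.AtomisticToContinuum.FouriersLaw.Theorems.JunctionLocalityNonBallisticDrudeLineDefs
import Summits.AtomisticToContinuum.FouriersLaw.Theorems.BondHeatUncertaintyLightConeBondHeatWeightedBalance
import Summits.AtomisticToContinuum.FouriersLaw.Theorems.BondHeatUncertaintySubdiffusiveBondHeatBathBondReductionGenerator
import Literature.MathematicalPhysics.KineticTheory.LangevinChainEnergyIdentity

/-!
# Stub `stub_totalHeatPathwiseIdentity` of line `drude-controls-conductance` (R1) — crux `JunctionLocality.NonBallistic`
(stmt-AtomisticToContinuum-9127)

The registered stub `stub_totalHeatPathwiseIdentity` (= `DrudeLine.TotalHeatPathwiseIdentity`, part 4 of the lead's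
split of the lever `TotalCurrentFTUR`) is proved below, sorry-free, from tree facts only (no neighbour stub is used):
for the pinned anharmonic chain `pinnedChain ω₂ lam β γ` (`ω₂ > 0`, `lam, β, γ ≥ 0`), `N ≥ 2`, bath sites `i0 = 0`,
`iN = N - 1`, any bond index `ib`, any temperatures `T_L, T_R`, `t ≥ 0`, EVERY initial point `z` and EVERY raw noise
sample `w`, along the forward path `X = fwdPath … z w` (the flow `OscillatorChain.solMap` driven by the Brownian pair of
`w`) the total-heat observable of the raw observable IS the time-integrated total current:

  `(N - 1)·Q_L - (M(X t) - M(z)) = ∫₀ᵗ Σ_i j_i(X s) ds`,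

`Q_L = leftHeat = Δ(p₀²/2) + ∫₀ᵗ p₀ ∂_{q₀}H`, `M = leftEnergyMoment` (site `i` weighs `N - 1 - i`, bond `(i, i+1)`
weighs `N - i - 3/2`), `j_i = OscillatorChain.bondCurrent`.

Proof. Pure calculus along the flow, in two pieces glued by Finset bookkeeping.

* `leftEnergyMoment_eq_weightedEnergy_add`: `M = W_{w'} + (N - 1) e₀`, where `W_{w'}` is the weighted site energy
  (`SubBallisticWindow.Negative.ClosedFlow.weightedEnergy`, bond energies split evenly) of the INTERIOR moment weights
  `w'_k = N - 1 - k` (`k ≥ 1`), `w'_0 = 0`, which vanish at both bath sites, and `e₀ = p₀²/2 + U(q₀) + ½V(q₁ - q₀)` is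
  the bath-site energy.
* The weighted local energy balance of the OPEN chain (`LightConeBondHeat.pinnedChain_weightedEnergy_solMap_eq`, valid
  for weights vanishing at the baths, path by path): `ΔW_{w'} = ∫₀ᵗ Σ_k (w'_{k+1} - w'_k) j_k(X s) ds`, and
  `Σ_k (w'_{k+1} - w'_k) j_k = (N - 1) j₀ - Σ_k j_k` (`sum_momentWeight_grad_mul`).
* The work–energy balance of the bath-site POTENTIAL energy (`pinnedChain_sitePotential_chainFlow_eq`, proved here by
  the chain rule along `y = z - (0, η)`, which is `C¹` with derivative the drift, so that every position is `C¹` with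
  `q_i' = p_i`, and the fundamental theorem of calculus): `Δ[U(q₀) + ½V(q₁ - q₀)] = ∫₀ᵗ p₀ ∂_{q₀}H - ∫₀ᵗ j₀`, i.e.
  `Q_L - Δe₀ = ∫₀ᵗ j₀` (the `b = 0` block balance; only positions are differentiated, so the noise, which lives on the
  bath momenta, never enters).

Then `(N-1)Q_L - ΔM = (N-1)(Q_L - Δe₀) - ΔW_{w'} = (N-1)∫₀ᵗ j₀ - ((N-1)∫₀ᵗ j₀ - ∫₀ᵗ Σ_k j_k) = ∫₀ᵗ Σ_k j_k`.
-/

noncomputable section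

open MeasureTheory Filter Topology Set
open scoped NNReal ENNReal BigOperators
open Literature.MathematicalPhysics.KineticTheory
open Literature.MathematicalPhysics.KineticTheory.HeatConduction
open Literature.Probability.Process

namespace Summit.AtomisticToContinuum.FouriersLaw.Theorems.NonBallistic

open OscillatorChain
open Summit.AtomisticToContinuum.FouriersLaw.Theorems.BondHeatUncertainty
open Summit.AtomisticToContinuum.FouriersLaw.Theorems.JunctionLocality
open Summit.AtomisticToContinuum.FouriersLaw.Theorems.NonBallistic.DrudeLine
open Summit.AtomisticToContinuum.FouriersLaw.Theorems.SubdiffusiveBondHeat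
open Summit.AtomisticToContinuum.FouriersLaw.Theorems.LightConeBondHeat
open Summit.AtomisticToContinuum.FouriersLaw.Theorems.SubBallisticWindow.Negative.ClosedFlow

variable {N : ℕ}

/-! ### Work–energy balance of the left bath-site potential energy along the driven flow -/

/-- **Work–energy balance of the potential energy attached to the left bath site, path by path.** For the flow
`z = chainFlow x η` of the pinned chain (`ω₂ > 0`, `lam, β, γ ≥ 0`) driven by ANY continuous momentum-noise path `η`,
sites `i0, i1` with values `0, 1` and `t ≥ 0`:
`[U(q₀) + ½V(q₁ - q₀)](z t) - [U(q₀) + ½V(q₁ - q₀)](x) = ∫₀ᵗ p₀ ∂_{q₀}H(z s) ds - ∫₀ᵗ j₀(z s) ds`.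
The positions are `C¹` along the flow with `q_i' = p_i` (`z - (0, η)` is `C¹` with derivative the drift `Y(z)`, whose
position block is `p`), so the left side is `∫₀ᵗ (U'(q₀)p₀ + ½V'(q₁-q₀)(p₁-p₀))`, and
`U'(q₀)p₀ + ½V'(q₁-q₀)(p₁-p₀) = p₀ (U'(q₀) - V'(q₁-q₀)) + ½(p₀+p₁)V'(q₁-q₀) = p₀ ∂_{q₀}H - j₀`
(`dPotential_siteZero`, `bondCurrent_siteZero`). [folklore] -/
theorem pinnedChain_sitePotential_chainFlow_eq {ω₂ lam β γ : ℝ} (hω : 0 < ω₂) (hl : 0 ≤ lam)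
    (hβ : 0 ≤ β) (hγ : 0 ≤ γ) {i0 i1 : Fin N} (hi0 : i0.val = 0) (hi1 : i1.val = 1)
    (x : PhaseSpace N) {η : ℝ → Fin N → ℝ} (hη : Continuous η) {t : ℝ} (ht : 0 ≤ t) :
    (pinnedChain ω₂ lam β γ).U (((pinnedChain ω₂ lam β γ).chainFlow N x η t).1 i0) +
          (pinnedChain ω₂ lam β γ).V (((pinnedChain ω₂ lam β γ).chainFlow N x η t).1 i1 -
            ((pinnedChain ω₂ lam β γ).chainFlow N x η t).1 i0) / 2 -
        ((pinnedChain ω₂ lam β γ).U (x.1 i0) + (pinnedChain ω₂ lam β γ).V (x.1 i1 - x.1 i0) / 2) =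
      (∫ s in (0 : ℝ)..t, ((pinnedChain ω₂ lam β γ).chainFlow N x η s).2 i0 *
          partialQ i0 ((pinnedChain ω₂ lam β γ).hamiltonian N) ((pinnedChain ω₂ lam β γ).chainFlow N x η s)) -
        ∫ s in (0 : ℝ)..t, (pinnedChain ω₂ lam β γ).bondCurrent N i0
          ((pinnedChain ω₂ lam β γ).chainFlow N x η s) := by
  set P := pinnedChain ω₂ lam β γ with hP
  set Y := P.drift N with hYdef
  set z := P.chainFlow N x η with hzdef
  have hU : Differentiable ℝ P.U := (pinnedChain_contDiff_U ω₂ lam β γ (n := 1)).differentiable one_ne_zero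
  have hV : Differentiable ℝ P.V := (pinnedChain_contDiff_V ω₂ lam β γ (n := 1)).differentiable one_ne_zero
  have hUc : Continuous (deriv P.U) := (pinnedChain_contDiff_U ω₂ lam β γ (n := 1)).continuous_deriv le_rfl
  have hVc : Continuous (deriv P.V) := (pinnedChain_contDiff_V ω₂ lam β γ (n := 1)).continuous_deriv le_rfl
  have hYc : Continuous Y := (pinnedChain_contDiff_drift ω₂ lam β γ N (n := 0)).continuous
  have hzc : Continuous z := pinnedChain_continuous_chainFlow hω hl hβ hγ N x hη
  have hz_eq : ∀ s ∈ Icc 0 t, z s = forcing x η s + ∫ r in (0 : ℝ)..s, Y (z r) :=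
    pinnedChain_isIntegralSolutionOn_chainFlow hω hl hβ hγ N x hη t
  have hHs : ContDiff ℝ 1 (P.hamiltonian N) := pinnedChain_contDiff_hamiltonian ω₂ lam β γ N
  have hQc : Continuous (partialQ i0 (P.hamiltonian N)) := P.continuous_partialQ_hamiltonian hHs i0
  -- `y(t) = x + ∫₀ᵗ Y(z)`, `y' = Y(z)`, `y.1 = z.1` on `[0, t]`
  set y : ℝ → PhaseSpace N := fun s => x + ∫ r in (0 : ℝ)..s, Y (z r) with hydef
  have hy_deriv : ∀ s, HasDerivAt y (Y (z s)) s := fun s => by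
    have h1 : HasDerivAt (fun u => ∫ r in (0 : ℝ)..u, Y (z r)) (Y (z s)) s :=
      ((hYc.comp hzc).integral_hasStrictDerivAt 0 s).hasDerivAt
    exact h1.const_add x
  have hyc : Continuous y := continuous_iff_continuousAt.2 fun s => (hy_deriv s).continuousAt
  have hy_eq : ∀ s ∈ Icc 0 t, y s = z s - ((0 : Fin N → ℝ), η s) := fun s hs => by
    rw [hz_eq s hs]
    simp only [hydef, forcing]
    abel
  have hy1 : ∀ s ∈ Icc 0 t, (y s).1 = (z s).1 := fun s hs => by
    rw [hy_eq s hs]; simp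
  have hy0 : y 0 = x := by simp [hydef]
  -- the position coordinates of `y` and their derivatives `q_i' = p_i`
  have hfst : ∀ s, HasDerivAt (fun s => (y s).1) ((Y (z s)).1) s := fun s =>
    (ContinuousLinearMap.fst ℝ (Fin N → ℝ) (Fin N → ℝ)).hasFDerivAt.comp_hasDerivAt s (hy_deriv s)
  have hq : ∀ i s, HasDerivAt (fun s => (y s).1 i) ((z s).2 i) s := fun i s =>
    hasDerivAt_pi.1 (hfst s) i
  have hy1c : ∀ i, Continuous fun s => (y s).1 i := fun i =>
    (continuous_apply i).comp (continuous_fst.comp hyc)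
  have hz2c : ∀ i, Continuous fun s => (z s).2 i := fun i =>
    (continuous_apply i).comp (continuous_snd.comp hzc)
  -- the `C¹` function `φ(s) = U(q₀) + ½ V(q₁ - q₀)` of the positions of `y`
  have hφ : ∀ s, HasDerivAt (fun s => P.U ((y s).1 i0) + P.V ((y s).1 i1 - (y s).1 i0) / 2)
      (deriv P.U ((y s).1 i0) * (z s).2 i0 +
        deriv P.V ((y s).1 i1 - (y s).1 i0) * ((z s).2 i1 - (z s).2 i0) / 2) s := by
    intro s
    have h1 : HasDerivAt (fun s => P.U ((y s).1 i0)) (deriv P.U ((y s).1 i0) * (z s).2 i0) s :=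
      ((hU ((y s).1 i0)).hasDerivAt).comp s (hq i0 s)
    have h2 : HasDerivAt (fun s => P.V ((y s).1 i1 - (y s).1 i0) / 2)
        (deriv P.V ((y s).1 i1 - (y s).1 i0) * ((z s).2 i1 - (z s).2 i0) / 2) s :=
      (((hV _).hasDerivAt).comp s ((hq i1 s).sub (hq i0 s))).div_const 2
    exact h1.add h2
  have hφc : Continuous fun s => deriv P.U ((y s).1 i0) * (z s).2 i0 +
      deriv P.V ((y s).1 i1 - (y s).1 i0) * ((z s).2 i1 - (z s).2 i0) / 2 :=
    ((hUc.comp (hy1c i0)).mul (hz2c i0)).add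
      (((hVc.comp ((hy1c i1).sub (hy1c i0))).mul ((hz2c i1).sub (hz2c i0))).div_const 2)
  -- the fundamental theorem of calculus on `[0, t]`
  have hFTC : ∫ s in (0 : ℝ)..t, (deriv P.U ((y s).1 i0) * (z s).2 i0 +
      deriv P.V ((y s).1 i1 - (y s).1 i0) * ((z s).2 i1 - (z s).2 i0) / 2) =
      (P.U ((y t).1 i0) + P.V ((y t).1 i1 - (y t).1 i0) / 2) -
        (P.U ((y 0).1 i0) + P.V ((y 0).1 i1 - (y 0).1 i0) / 2) :=
    intervalIntegral.integral_eq_sub_of_hasDerivAt (fun s _ => hφ s) (hφc.intervalIntegrable _ _)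
  -- the integrand on `[0, t]` is `p₀ ∂_{q₀}H(z) - j₀(z)`
  have hint : ∀ s ∈ uIcc 0 t, deriv P.U ((y s).1 i0) * (z s).2 i0 +
      deriv P.V ((y s).1 i1 - (y s).1 i0) * ((z s).2 i1 - (z s).2 i0) / 2 =
      (z s).2 i0 * partialQ i0 (P.hamiltonian N) (z s) - P.bondCurrent N i0 (z s) := by
    intro s hs
    rw [uIcc_of_le ht] at hs
    rw [hy1 s hs, P.partialQ_hamiltonian_eq_dPotential hU hV, dPotential_siteZero P hi0 hi1,
      bondCurrent_siteZero P (i0 := i0) (i1 := i1) (by omega) (z s)]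
    ring
  have hI1 : IntervalIntegrable (fun s => (z s).2 i0 * partialQ i0 (P.hamiltonian N) (z s)) volume 0 t :=
    ((hz2c i0).mul (hQc.comp hzc)).intervalIntegrable _ _
  have hI2 : IntervalIntegrable (fun s => P.bondCurrent N i0 (z s)) volume 0 t :=
    ((pinnedChain_continuous_bondCurrent ω₂ lam β γ N i0).comp hzc).intervalIntegrable _ _
  rw [← intervalIntegral.integral_sub hI1 hI2, ← intervalIntegral.integral_congr hint, hFTC, hy0,
    hy1 t ⟨ht, le_rfl⟩]


/-- The same balance along the constructed flow `Φ_t(x, w') = OscillatorChain.solMap` (the noise `chainNoise` of a raw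
pair of paths `w'` is continuous in time for EVERY `w'`). [folklore] -/
theorem pinnedChain_sitePotential_solMap_eq {ω₂ lam β γ : ℝ} (hω : 0 < ω₂) (hl : 0 ≤ lam)
    (hβ : 0 ≤ β) (hγ : 0 ≤ γ) (T_L T_R : ℝ) {i0 i1 : Fin N} (hi0 : i0.val = 0) (hi1 : i1.val = 1)
    (x : PhaseSpace N) (w' : WienerPair) {t : ℝ} (ht : 0 ≤ t) :
    (pinnedChain ω₂ lam β γ).U (((pinnedChain ω₂ lam β γ).solMap N T_L T_R t x w').1 i0) +
          (pinnedChain ω₂ lam β γ).V (((pinnedChain ω₂ lam β γ).solMap N T_L T_R t x w').1 i1 -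
            ((pinnedChain ω₂ lam β γ).solMap N T_L T_R t x w').1 i0) / 2 -
        ((pinnedChain ω₂ lam β γ).U (x.1 i0) + (pinnedChain ω₂ lam β γ).V (x.1 i1 - x.1 i0) / 2) =
      (∫ s in (0 : ℝ)..t, ((pinnedChain ω₂ lam β γ).solMap N T_L T_R s x w').2 i0 *
          partialQ i0 ((pinnedChain ω₂ lam β γ).hamiltonian N) ((pinnedChain ω₂ lam β γ).solMap N T_L T_R s x w')) -
        ∫ s in (0 : ℝ)..t, (pinnedChain ω₂ lam β γ).bondCurrent N i0
          ((pinnedChain ω₂ lam β γ).solMap N T_L T_R s x w') := by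
  unfold OscillatorChain.solMap
  exact pinnedChain_sitePotential_chainFlow_eq hω hl hβ hγ hi0 hi1 x (continuous_chainNoise _ _ w') ht

/-! ### Bookkeeping: the left energy moment as a weighted energy plus `(N - 1)` bath-site energies -/

/-- The discrete gradient of the interior moment weights `w'_k = N - 1 - k` (`k ≥ 1`), `w'_0 = 0`:
`w'_{k+1} - w'_k = (N - 1)[k = 0] - 1` on the sites `k < N`. [folklore] -/
theorem momentWeight_grad (i0 : Fin N) (hi0 : i0.val = 0) (wt : ℕ → ℝ)
    (hwt : wt = fun k : ℕ => if k = 0 then (0 : ℝ) else (N : ℝ) - 1 - k) (k : Fin N) :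
    wt (k.val + 1) - wt k.val = (if k = i0 then (N : ℝ) - 1 else 0) - 1 := by
  subst hwt
  by_cases hk : k = i0
  · subst hk
    simp only [Nat.succ_ne_zero, if_false, hi0, if_true, Nat.cast_add, Nat.cast_zero, Nat.cast_one]
    ring
  · have hk' : k.val ≠ 0 := fun h => hk (Fin.ext (by omega))
    simp only [Nat.succ_ne_zero, if_false, hk', hk, Nat.cast_add, Nat.cast_one]
    ring

/-- Summing the bond currents against the discrete gradient of the interior moment weights:
`Σ_k (w'_{k+1} - w'_k) j_k = (N - 1) j_0 - Σ_k j_k`. [folklore] -/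
theorem sum_momentWeight_grad_mul (i0 : Fin N) (hi0 : i0.val = 0) (wt : ℕ → ℝ)
    (hwt : wt = fun k : ℕ => if k = 0 then (0 : ℝ) else (N : ℝ) - 1 - k) (j : Fin N → ℝ) :
    ∑ k : Fin N, (wt (k.val + 1) - wt k.val) * j k = ((N : ℝ) - 1) * j i0 - ∑ k : Fin N, j k := by
  have h : ∀ k : Fin N, (wt (k.val + 1) - wt k.val) * j k =
      (if k = i0 then ((N : ℝ) - 1) * j k else 0) - j k := by
    intro k
    rw [momentWeight_grad i0 hi0 wt hwt k]
    split_ifs <;> ring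
  rw [Finset.sum_congr rfl fun k _ => h k, Finset.sum_sub_distrib, Finset.sum_ite_eq' Finset.univ i0]
  simp

/-- The interior moment weights vanish at the two bath sites `0` and `N - 1`. [folklore] -/
theorem momentWeight_bath (wt : ℕ → ℝ) (hwt : wt = fun k : ℕ => if k = 0 then (0 : ℝ) else (N : ℝ) - 1 - k)
    (i : Fin N) (hi : i.val = 0 ∨ i.val = N - 1) : wt i.val = 0 := by
  subst hwt
  rcases hi with h | h
  · simp [h]
  · have hN : 1 ≤ N := by have := i.isLt; omega
    simp only [h]
    split_ifs with h0
    · rfl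
    · rw [Nat.cast_sub hN, Nat.cast_one]
      ring

/-- **The left energy moment is the weighted energy of the interior moment weights plus `(N - 1)` copies of the
bath-site energy** `e₀ = p₀²/2 + U(q₀) + ½V(q₁ - q₀)`: `M = W_{w'} + (N - 1) e₀` with `w'_k = N - 1 - k` for `k ≥ 1`,
`w'_0 = 0` (site `i` weighs `N - 1 - i = w'_i + (N-1)[i=0]`; bond `(i, i+1)` weighs
`N - i - 3/2 = (w'_i + w'_{i+1})/2 + (N-1)/2·[i=0]`). [folklore] -/
theorem leftEnergyMoment_eq_weightedEnergy_add (P : OscillatorChain) {i0 i1 : Fin N} (hi0 : i0.val = 0)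
    (hi1 : i1.val = 1) (wt : ℕ → ℝ) (hwt : wt = fun k : ℕ => if k = 0 then (0 : ℝ) else (N : ℝ) - 1 - k)
    (x : PhaseSpace N) :
    leftEnergyMoment P N x = weightedEnergy P wt N x +
      ((N : ℝ) - 1) * (x.2 i0 ^ 2 / 2 + P.U (x.1 i0) + P.V (x.1 i1 - x.1 i0) / 2) := by
  -- the two extra terms as sums over the sites / bonds
  have h1 : ((N : ℝ) - 1) * (x.2 i0 ^ 2 / 2 + P.U (x.1 i0)) =
      ∑ i : Fin N, (if i = i0 then ((N : ℝ) - 1) * (x.2 i ^ 2 / 2 + P.U (x.1 i)) else 0) := by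
    rw [Finset.sum_ite_eq' Finset.univ i0]
    simp
  have h2 : ((N : ℝ) - 1) * (P.V (x.1 i1 - x.1 i0) / 2) =
      ∑ i : Fin N, ∑ j : Fin N, (if j.val = i.val + 1 then
        (if i = i0 then ((N : ℝ) - 1) / 2 * P.V (x.1 j - x.1 i) else 0) else 0) := by
    rw [Fintype.sum_eq_single i0, Fintype.sum_eq_single i1]
    · have h : i1.val = i0.val + 1 := by omega
      simp only [h, if_true]
      ring
    · intro j hj
      have h : ¬ (j.val = i0.val + 1) := fun h' => hj (Fin.ext (by omega))
      simp only [h, if_false]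
    · intro i hi
      simp only [hi, if_false, ite_self, Finset.sum_const_zero]
  -- termwise comparison
  have key : ∀ i : Fin N, ((N : ℝ) - 1 - (i : ℕ)) * (x.2 i ^ 2 / 2 + P.U (x.1 i)) +
      ∑ j : Fin N, (if j.val = i.val + 1 then ((N : ℝ) - (i : ℕ) - 3 / 2) * P.V (x.1 j - x.1 i) else 0) =
      (wt i.val * (x.2 i ^ 2 / 2 + P.U (x.1 i)) +
          (if i = i0 then ((N : ℝ) - 1) * (x.2 i ^ 2 / 2 + P.U (x.1 i)) else 0)) +
        ∑ j : Fin N, ((if j.val = i.val + 1 then ((wt i.val + wt j.val) / 2) * P.V (x.1 j - x.1 i) else 0) +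
          (if j.val = i.val + 1 then
            (if i = i0 then ((N : ℝ) - 1) / 2 * P.V (x.1 j - x.1 i) else 0) else 0)) := by
    intro i
    subst hwt
    beta_reduce
    congr 1
    · by_cases hi : i = i0
      · subst hi
        rw [if_pos rfl, if_pos hi0, hi0]
        push_cast
        ring
      · have hi' : i.val ≠ 0 := fun h => hi (Fin.ext (by omega))
        rw [if_neg hi, if_neg hi']
        ring
    · refine Finset.sum_congr rfl fun j _ => ?_
      by_cases hj : j.val = i.val + 1
      · have hj0 : j.val ≠ 0 := by omega
        simp only [if_pos hj, if_neg hj0]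
        by_cases hi : i = i0
        · subst hi
          rw [if_pos rfl, if_pos hi0, hj, hi0]
          push_cast
          ring
        · have hi' : i.val ≠ 0 := fun h => hi (Fin.ext (by omega))
          rw [if_neg hi, if_neg hi', hj]
          push_cast
          ring
      · simp only [if_neg hj, add_zero]
  have hsplit : ((N : ℝ) - 1) * (x.2 i0 ^ 2 / 2 + P.U (x.1 i0) + P.V (x.1 i1 - x.1 i0) / 2) =
      ((N : ℝ) - 1) * (x.2 i0 ^ 2 / 2 + P.U (x.1 i0)) + ((N : ℝ) - 1) * (P.V (x.1 i1 - x.1 i0) / 2) := by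
    ring
  unfold leftEnergyMoment weightedEnergy
  rw [Finset.sum_congr rfl fun i _ => key i, hsplit, h1, h2]
  simp only [Finset.sum_add_distrib]
  ring

/-! ### The stub -/

/-- **Stub `stub_totalHeatPathwiseIdentity`** (= `DrudeLine.TotalHeatPathwiseIdentity`; pure calculus along the flow,
no probability): for the pinned chain (`ω₂ > 0`, `lam, β, γ ≥ 0`), `N ≥ 2`, bath sites `i0 = 0`, `iN = N - 1`, any
index `ib`, any temperatures, `t ≥ 0`, EVERY initial point `z` and EVERY raw noise sample `w`: along the forward path
`X = fwdPath` the total-heat observable of the raw observable equals the time-integrated total current,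
`(N-1)·Q_L - (M(X t) - M(z)) = ∫₀ᵗ Σ_i j_i(X s) ds`. Proof: write `M = W_{w'} + (N-1) e₀` with the interior moment
weights `w'` (`leftEnergyMoment_eq_weightedEnergy_add`), which vanish at both bath sites, so that the weighted local
energy balance of the open chain (`LightConeBondHeat.pinnedChain_weightedEnergy_solMap_eq`) gives
`ΔW_{w'} = ∫₀ᵗ Σ_k (w'_{k+1} - w'_k) j_k = (N-1)∫₀ᵗ j₀ - ∫₀ᵗ Σ_k j_k`; and `Q_L - Δe₀ = ∫₀ᵗ p₀∂_{q₀}H - Δ[U(q₀) +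
½V(q₁-q₀)] = ∫₀ᵗ j₀` by the work–energy balance of the bath-site potential energy
(`pinnedChain_sitePotential_solMap_eq`, `Q_L = Δ(p₀²/2) + ∫₀ᵗ p₀∂_{q₀}H` by definition of `leftHeat`). [folklore] -/
theorem stub_totalHeatPathwiseIdentity :
    ∀ ω₂ lam β γ : ℝ, 0 < ω₂ → 0 ≤ lam → 0 ≤ β → 0 ≤ γ →
    ∀ (N : ℕ) (i0 iN ib : Fin N), 2 ≤ N → i0.val = 0 → iN.val = N - 1 →
    ∀ (T_L T_R t : ℝ), 0 ≤ t → ∀ (z : PhaseSpace N) (w : WienerPair),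
      totalHeatObs (pinnedChain ω₂ lam β γ) N i0
          (rawObs (pinnedChain ω₂ lam β γ) N i0 iN ib t z (fwdPath (pinnedChain ω₂ lam β γ) N T_L T_R z w)) =
        timeIntegratedCurrent (pinnedChain ω₂ lam β γ) N T_L T_R t (z, w) := by
  intro ω₂ lam β γ hω hl hβ hγ N i0 iN ib hN hi0 _ T_L T_R t ht z w
  obtain ⟨i1, hi1⟩ : ∃ i1 : Fin N, i1.val = 1 := ⟨⟨1, by omega⟩, rfl⟩
  set wt : ℕ → ℝ := fun k => if k = 0 then (0 : ℝ) else (N : ℝ) - 1 - k with hwt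
  -- continuity of the path and interval integrability of the currents along it
  have hXc : Continuous fun s => (pinnedChain ω₂ lam β γ).solMap N T_L T_R s z (pairPath w) :=
    pinnedChain_continuous_solMap hω hl hβ hγ N T_L T_R z (pairPath w)
  have hIj : ∀ i : Fin N, IntervalIntegrable (fun s => (pinnedChain ω₂ lam β γ).bondCurrent N i
      ((pinnedChain ω₂ lam β γ).solMap N T_L T_R s z (pairPath w))) volume 0 t := fun i =>
    ((pinnedChain_continuous_bondCurrent ω₂ lam β γ N i).comp hXc).intervalIntegrable _ _
  have hIJ : IntervalIntegrable (fun s => ∑ i : Fin N, (pinnedChain ω₂ lam β γ).bondCurrent N i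
      ((pinnedChain ω₂ lam β γ).solMap N T_L T_R s z (pairPath w))) volume 0 t :=
    (continuous_finsetSum _ fun i _ => (pinnedChain_continuous_bondCurrent ω₂ lam β γ N i).comp hXc).intervalIntegrable
      _ _
  -- (1) the weighted local energy balance for the interior moment weights
  have hW := pinnedChain_weightedEnergy_solMap_eq hω hl hβ hγ T_L T_R wt (momentWeight_bath wt hwt) z (pairPath w) ht
  have hgrad : ∀ s, ∑ k : Fin N, (wt (k.val + 1) - wt k.val) *
      (pinnedChain ω₂ lam β γ).bondCurrent N k ((pinnedChain ω₂ lam β γ).solMap N T_L T_R s z (pairPath w)) =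
      ((N : ℝ) - 1) * (pinnedChain ω₂ lam β γ).bondCurrent N i0
          ((pinnedChain ω₂ lam β γ).solMap N T_L T_R s z (pairPath w)) -
        ∑ k : Fin N, (pinnedChain ω₂ lam β γ).bondCurrent N k
          ((pinnedChain ω₂ lam β γ).solMap N T_L T_R s z (pairPath w)) := fun s =>
    sum_momentWeight_grad_mul i0 hi0 wt hwt _
  have hWint : ∫ s in (0 : ℝ)..t, ∑ k : Fin N, (wt (k.val + 1) - wt k.val) *
      (pinnedChain ω₂ lam β γ).bondCurrent N k ((pinnedChain ω₂ lam β γ).solMap N T_L T_R s z (pairPath w)) =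
      ((N : ℝ) - 1) * (∫ s in (0 : ℝ)..t, (pinnedChain ω₂ lam β γ).bondCurrent N i0
          ((pinnedChain ω₂ lam β γ).solMap N T_L T_R s z (pairPath w))) -
        ∫ s in (0 : ℝ)..t, ∑ k : Fin N, (pinnedChain ω₂ lam β γ).bondCurrent N k
          ((pinnedChain ω₂ lam β γ).solMap N T_L T_R s z (pairPath w)) := by
    rw [intervalIntegral.integral_congr fun s _ => hgrad s, intervalIntegral.integral_sub ((hIj i0).const_mul _) hIJ,
      intervalIntegral.integral_const_mul]
  rw [hWint] at hW
  -- (2) the work–energy balance of the bath-site potential energy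
  have hF := pinnedChain_sitePotential_solMap_eq hω hl hβ hγ T_L T_R hi0 hi1 z (pairPath w) ht
  -- (3) unfold the vocabulary and conclude
  rw [totalHeatObs_def, timeIntegratedCurrent_def]
  simp only [leftHeat, rawObs_apply, fwdPath_apply, totalCurrentObs_def]
  rw [leftEnergyMoment_eq_weightedEnergy_add (pinnedChain ω₂ lam β γ) hi0 hi1 wt hwt,
    leftEnergyMoment_eq_weightedEnergy_add (pinnedChain ω₂ lam β γ) hi0 hi1 wt hwt]
  linear_combination -hW - ((N : ℝ) - 1) * hF

end Summit.AtomisticToContinuum.FouriersLaw.Theorems.NonBallistic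

end
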